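import Mathlib
import Summits.ValiantsHypothesis.ValiantsHypothesis.Theses.GrenetZeon
import Summits.ValiantsHypothesis.ValiantsHypothesis.Theorems.GrenetZeonTwoDimCoefficientsAfterCodimTwo
import Summits.ValiantsHypothesis.ValiantsHypothesis.Theorems.GrenetZeonTwoDimCoefficientsDualUnipotentConstrainedPencil

/-!
# Route `GrenetZeon`: the FRONTIER RUNG `DualUnipotentThreeHalves` (stmt-ValiantsHypothesis-24318)
# is formally BELOW the crux `TwoDimCoefficients` (stmt-ValiantsHypothesis-8062) — by name

Bookkeeping between the two open items of the route that share the unipotent dual model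
(`DualUnipotentRepr n m`: `per_n = α·det A + β·tr(adj A·B)`, `A`, `B` affine `m × m`,
`det A ≡ c ≠ 0`):

* `dualUnipotentThreeHalves_iff` — the route decl `Theses.GrenetZeon.DualUnipotentThreeHalves`
  unfolds (`Iff.rfl`) to `∃ C n₀, ∀ n ≥ n₀, ∀ m, DualUnipotentRepr n m → n³ ≤ C·m²`.
* `dualUnipotentThreeHalves_of_dualUnipotentBound` — the open stub of 8062
  (`DualUnipotentBound`: `n² ≤ C·m`) implies the rung (with constant `C²`: `n³ ≤ n⁴ ≤ (C·m)²`);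
  `dualUnipotentThreeHalves_of_twoDimCoefficients` — so does the crux `TwoDimCoefficients` itself
  (via the tree's `twoDimCoefficients_iff_dualUnipotentBound_all`): **24318 ⟸ 8062 by name**.
* `dualUnipotentThreeHalves_iff_constrainedPencil` — the rung in pencil currency
  (`dualUnipotentRepr_iff_constrainedPencil`): constrained nilpotent LINEAR pencils
  (`N^m = 0`, `per_n = tr(N^{n−1}·M)`, `tr(N^j·M) = 0` for `j ≠ n − 1`) have `n³ ≤ C·m²`.

Calibration remark (no new theorem): in TRACE-PRODUCT currency (`per_n = tr(X₁⋯X_n)`, width `w`,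
embedded at `m = n·w` by `dualUnipotentRepr_of_trace_prod`) the rung only says `n ≤ C·w²`, which
is ALREADY PROVED unconditionally (`le_two_mul_sq_of_trace_prod`: `n ≤ 2w²`, Mignon–Ressayre);
the content of 24318 lies entirely in non-layered pencils (`m < n·w`).

HONEST FRAMING: implications between open statements and an unfolding; neither item is proved;
`VP ≠ VNP` is not moved by anything here.
-/

-- single-conjunct layout `Summits/ValiantsHypothesis/ValiantsHypothesis`: the duplicated namespace
-- component is mandated by the tree.
set_option linter.dupNamespace false

noncomputable section

namespace Summit.ValiantsHypothesis.ValiantsHypothesis.Cruxes.TwoDimCoefficients.DimTwoCases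

open Literature.Computability.AlgebraicComplexity Matrix MvPolynomial
open Summit.ValiantsHypothesis.ValiantsHypothesis.Theses.GrenetZeon

/-- **Unfolding.** The route decl `DualUnipotentThreeHalves` is, definitionally, the statement
`∃ C n₀, ∀ n ≥ n₀, ∀ m, DualUnipotentRepr n m → n³ ≤ C·m²`. [folklore] -/
theorem dualUnipotentThreeHalves_iff :
    DualUnipotentThreeHalves ↔
      ∃ C n₀ : ℕ, ∀ n ≥ n₀, ∀ m : ℕ, DualUnipotentRepr n m → n ^ 3 ≤ C * m ^ 2 :=
  Iff.rfl

/-- **The rung is below the stub:** `DualUnipotentBound → DualUnipotentThreeHalves`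
(`n² ≤ C·m` gives `n³ ≤ n⁴ ≤ C²·m²`). [folklore] -/
theorem dualUnipotentThreeHalves_of_dualUnipotentBound (h : DualUnipotentBound) :
    DualUnipotentThreeHalves := by
  rw [dualUnipotentThreeHalves_iff]
  obtain ⟨C, n₀, hC⟩ := h
  refine ⟨C ^ 2, n₀, fun n hn m hrep => ?_⟩
  have h2 : n ^ 2 ≤ C * m := hC n hn m hrep
  have h4 : n ^ 2 * n ^ 2 ≤ (C * m) * (C * m) := Nat.mul_le_mul h2 h2
  rcases Nat.eq_zero_or_pos n with rfl | hpos
  · simp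
  · calc n ^ 3 ≤ n ^ 4 := Nat.pow_le_pow_right hpos (by norm_num)
      _ = n ^ 2 * n ^ 2 := by ring
      _ ≤ (C * m) * (C * m) := h4
      _ = C ^ 2 * m ^ 2 := by ring

/-- **24318 ⟸ 8062 by name:** the crux `TwoDimCoefficients` implies the rung
`DualUnipotentThreeHalves` (the crux is equivalent to `DualUnipotentBound`,
`twoDimCoefficients_iff_dualUnipotentBound_all`). [folklore] -/
theorem dualUnipotentThreeHalves_of_twoDimCoefficients (h : TwoDimCoefficients) :
    DualUnipotentThreeHalves :=
  dualUnipotentThreeHalves_of_dualUnipotentBound (twoDimCoefficients_iff_dualUnipotentBound_all.1 h)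

/-- **The rung in pencil currency.** `DualUnipotentThreeHalves` is EQUIVALENT to: there are `C`,
`n₀` such that for `n ≥ n₀` every constrained nilpotent linear pencil carrying `per_n` (`N`, `M`
linear `m × m`, `N^m = 0`, `per_n = tr(N^{n−1}·M)`, `tr(N^j·M) = 0` for `j ≠ n − 1`) has
`n³ ≤ C·m²`. [folklore] -/
theorem dualUnipotentThreeHalves_iff_constrainedPencil :
    DualUnipotentThreeHalves ↔
      ∃ C n₀ : ℕ, ∀ n ≥ n₀, ∀ m : ℕ,
        (∃ N M : AffMat n m, (∀ i j, (N i j).IsHomogeneous 1) ∧ (∀ i j, (M i j).IsHomogeneous 1) ∧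
          N ^ m = 0 ∧ perPoly (Fin n) ℂ = (N ^ (n - 1) * M).trace ∧
          ∀ j : ℕ, j ≠ n - 1 → (N ^ j * M).trace = 0) → n ^ 3 ≤ C * m ^ 2 := by
  rw [dualUnipotentThreeHalves_iff]
  constructor
  · rintro ⟨C, n₀, h⟩
    refine ⟨C, max n₀ 1, fun n hn m hP => h n (le_of_max_le_left hn) m ?_⟩
    exact (dualUnipotentRepr_iff_constrainedPencil (le_of_max_le_right hn)).2 hP
  · rintro ⟨C, n₀, h⟩
    refine ⟨C, max n₀ 1, fun n hn m hrep => h n (le_of_max_le_left hn) m ?_⟩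
    exact (dualUnipotentRepr_iff_constrainedPencil (le_of_max_le_right hn)).1 hrep

end Summit.ValiantsHypothesis.ValiantsHypothesis.Cruxes.TwoDimCoefficients.DimTwoCases

end
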